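import Literature.NumberTheory.LFunctions.UniformWeilPositivityRH
import Literature.NumberTheory.LFunctions.WeilMarkovQuadratic
import Literature.NumberTheory.LFunctions.RiemannSiegel
import HarnessLib

/-!
# RiemannHypothesis / SpectralTrace — crux `WindowStep`, line `Sketch`: calibration of the held stub

Route `RiemannHypothesis/SpectralTrace`, crux item stmt-RiemannHypothesis-14659 (`WindowStep`), line `Sketch`
(skeleton `Cruxes/WindowStep/Lines/Sketch.lean`, composition `WindowStep_of` over the registered stubs
`stub_densityForm`, `stub_cutoffInvariance`, `stub_highZone`, `stub_windowGrowth`). Helper file (`--supports`).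

**What is proved (pure bookkeeping, unconditional).** Write
`PositivityStep := ∀ n ≥ 2, WeilPositivityOn ((log n)/2) → WeilPositivityOn ((log (n+1))/2)` — the rung-by-rung
climb of Weil positivity on half windows. Then

* `riemannHypothesis_iff_positivityStep : RiemannHypothesis ↔ PositivityStep` — the climb IS the Riemann
  hypothesis: (→) RH gives Weil positivity on every window (`riemannHypothesis_iff_forall_weilPositivityOn`);
  (←) Yoshida's archimedean seed `WeilPositivityOn ((log 2)/2)` (`weilPositivityOn_of_le_log_two_half`, proved in
  the tree) and the climb give every rung `(log n)/2`, rungs exhaust all windows (`WeilPositivityOn.mono`), and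
  Yoshida/Weil's criterion (`riemannHypothesis_iff_forall_weilPositivityOn`, unconditional in the tree) gives RH;
* `windowGrowth_iff_positivityStep` — GIVEN the three analytic statements of the line as hypotheses (density
  form, cutoff invariance, high zone; each is being landed as its own stub file and is spelled out verbatim here,
  nothing is assumed about them in the unconditional results), the registered RH-strength stub
  `stub_windowGrowth` (density positivity climbs one rung at fixed prime cutoff) is equivalent to
  `PositivityStep`; hence `windowGrowth_iff_riemannHypothesis` under the same hypotheses.

So the line `Sketch` isolates in its held stub exactly RH — no more (it is RH-implied, irrefutable short of `¬RH`)
and no less — as the landed negative lemma `Theorems/WindowStep/Negative/Collapse.lean`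
(`WindowStep ↔ (WindowTraceArch → RH)`) says every line for this crux must; what the line adds is the currency:
per rung, `PositivityStep n` is a zero-free inequality for an explicit quadratic form (density form) whose
negativity region in frequency is bounded (high zone).

No new definitions (the statements are spelled inline / as local notation); no named fact is used.
-/

-- the summit-side namespace `Summit.RiemannHypothesis.RiemannHypothesis.…` (single-conjunct summit, D-0017)
-- repeats `RiemannHypothesis` by design
set_option linter.dupNamespace false

noncomputable section

open Complex MeasureTheory Set

namespace Summit.RiemannHypothesis.RiemannHypothesis.Theorems.SpectralTraceWindowStep

open Literature.NumberTheory.LFunctions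

/-- File-local spelling of density positivity on the window `[-a, a]` at prime cutoff `S`
(the `DensityPos a S` of the skeleton `Cruxes/WindowStep/Lines/Sketch.lean`): a notation, not a definition. -/
local notation3 "DPos(" a ", " S ")" => ∀ g : ℝ → ℂ, IsWeilTest g → tsupport g ⊆ Set.Icc (-a) a →
  0 ≤ weilPoleForm g + 1 / Real.pi *
    ((∫ t : ℝ, ‖weilMellin g (1 / 2 + t * Complex.I)‖ ^ 2 * riemannSiegelThetaDeriv t) -
      ∑ m ∈ S, (ArithmeticFunction.vonMangoldt m : ℝ) / Real.sqrt m *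
        ∫ t : ℝ, ‖weilMellin g (1 / 2 + t * Complex.I)‖ ^ 2 * Real.cos (t * Real.log m))

/-! ## The positivity climb is the Riemann hypothesis -/

/-- **RH ⇒ the positivity climb**: under RH, Weil positivity holds on every window
(`riemannHypothesis_iff_forall_weilPositivityOn`), in particular on every `[-(log (n+1))/2, (log (n+1))/2]`.
[folklore] -/
theorem positivityStep_of_riemannHypothesis (hRH : RiemannHypothesis) :
    ∀ n : ℕ, 2 ≤ n → WeilPositivityOn (Real.log n / 2) →
      WeilPositivityOn (Real.log ((n : ℝ) + 1) / 2) := by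
  intro n hn _
  refine riemannHypothesis_iff_forall_weilPositivityOn.1 hRH _ ?_
  have h2 : (2 : ℝ) ≤ n := by exact_mod_cast hn
  have : (0 : ℝ) < Real.log ((n : ℝ) + 1) := Real.log_pos (by linarith)
  linarith

/-- **The positivity climb gives every rung**: from Yoshida's seed `WeilPositivityOn ((log 2)/2)` (proved in
the tree) and the climb, `WeilPositivityOn ((log n)/2)` for every `n ≥ 2`. [folklore] -/
theorem weilPositivityOn_rung_of_positivityStep
    (hStep : ∀ n : ℕ, 2 ≤ n → WeilPositivityOn (Real.log n / 2) →
      WeilPositivityOn (Real.log ((n : ℝ) + 1) / 2)) :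
    ∀ n : ℕ, 2 ≤ n → WeilPositivityOn (Real.log n / 2) := by
  intro n hn
  induction n, hn using Nat.le_induction with
  | base =>
    simp only [Nat.cast_ofNat]
    exact weilPositivityOn_of_le_log_two_half le_rfl
  | succ k hk ih =>
    have h := hStep k hk ih
    push_cast
    exact h

/-- **The positivity climb ⇒ RH**: the rungs `(log n)/2` exhaust all windows (`WeilPositivityOn.mono`),
so the climb gives `WeilPositivityOn a` for every `a > 0`, which is RH by Yoshida/Weil's criterion
(`riemannHypothesis_iff_forall_weilPositivityOn`, unconditional in the tree). [folklore] -/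
theorem riemannHypothesis_of_positivityStep
    (hStep : ∀ n : ℕ, 2 ≤ n → WeilPositivityOn (Real.log n / 2) →
      WeilPositivityOn (Real.log ((n : ℝ) + 1) / 2)) :
    RiemannHypothesis := by
  refine riemannHypothesis_iff_forall_weilPositivityOn.2 fun a _ => ?_
  obtain ⟨m, hm⟩ := exists_nat_ge (Real.exp (2 * a))
  have hm2 : 2 ≤ max 2 m := le_max_left 2 m
  refine WeilPositivityOn.mono ?_ (weilPositivityOn_rung_of_positivityStep hStep (max 2 m) hm2)
  have hpos : (0 : ℝ) < ((max 2 m : ℕ) : ℝ) := by positivity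
  have hle : 2 * a ≤ Real.log ((max 2 m : ℕ) : ℝ) := by
    rw [Real.le_log_iff_exp_le hpos]
    exact hm.trans (by exact_mod_cast le_max_right 2 m)
  linarith

/-- **Calibration, I: the positivity climb is exactly the Riemann hypothesis.** [folklore] -/
theorem riemannHypothesis_iff_positivityStep :
    RiemannHypothesis ↔
      ∀ n : ℕ, 2 ≤ n → WeilPositivityOn (Real.log n / 2) →
        WeilPositivityOn (Real.log ((n : ℝ) + 1) / 2) :=
  ⟨positivityStep_of_riemannHypothesis, riemannHypothesis_of_positivityStep⟩

/-! ## The registered stub `stub_windowGrowth` is the positivity climb (given the analytic stubs) -/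

/-- Cutoff realignment: given cutoff invariance (`∫ |ĝ(½+it)|² cos(t x) dt = 0` for `2a ≤ |x|`), density
positivity on `[-b, b]` at the cutoffs `weilPrimeIndex b ⊆ weilPrimeIndex c` (`b ≤ c`) is the same statement:
the extra candidates `m` have `log m ≥ 2b`. [folklore] -/
theorem densityPos_realign
    (hCI : ∀ (g : ℝ → ℂ) (a x : ℝ), IsWeilTest g → tsupport g ⊆ Set.Icc (-a) a → 2 * a ≤ |x| →
      ∫ t : ℝ, ‖weilMellin g (1 / 2 + t * Complex.I)‖ ^ 2 * Real.cos (t * x) = 0)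
    {b c : ℝ} (hbc : b ≤ c) :
    DPos(b, weilPrimeIndex b) ↔ DPos(b, weilPrimeIndex c) := by
  have key : ∀ g : ℝ → ℂ, IsWeilTest g → tsupport g ⊆ Icc (-b) b →
      ∑ m ∈ weilPrimeIndex c, (ArithmeticFunction.vonMangoldt m : ℝ) / Real.sqrt m *
          ∫ t : ℝ, ‖weilMellin g (1 / 2 + t * I)‖ ^ 2 * Real.cos (t * Real.log m) =
        ∑ m ∈ weilPrimeIndex b, (ArithmeticFunction.vonMangoldt m : ℝ) / Real.sqrt m *
          ∫ t : ℝ, ‖weilMellin g (1 / 2 + t * I)‖ ^ 2 * Real.cos (t * Real.log m) := by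
    intro g hg hgs
    rw [← Finset.sum_sdiff (fun m hm ↦ mem_weilPrimeIndex.2 ((mem_weilPrimeIndex.1 hm).trans_le
      (by linarith : 2 * b ≤ 2 * c)) : weilPrimeIndex b ⊆ weilPrimeIndex c), add_eq_right]
    refine Finset.sum_eq_zero fun m hm => ?_
    rw [Finset.mem_sdiff, mem_weilPrimeIndex, mem_weilPrimeIndex, not_lt] at hm
    rw [hCI g b (Real.log m) hg hgs (hm.2.trans (le_abs_self _)), mul_zero]
  constructor
  · intro h g hg hgs
    rw [key g hg hgs]
    exact h g hg hgs
  · intro h g hg hgs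
    rw [← key g hg hgs]
    exact h g hg hgs

/-- Density form: given the density-form identity, `WeilPositivityOn a` is density positivity on `[-a, a]`
at cutoff `weilPrimeIndex a`. [folklore] -/
theorem weilPositivityOn_iff_densityPos
    (hDF : ∀ (g : ℝ → ℂ) (a : ℝ), IsWeilTest g → tsupport g ⊆ Set.Icc (-a) a →
      (weilQuadratic g).re = weilPoleForm g + 1 / Real.pi *
        ((∫ t : ℝ, ‖weilMellin g (1 / 2 + t * Complex.I)‖ ^ 2 * riemannSiegelThetaDeriv t) -
          ∑ m ∈ weilPrimeIndex a, (ArithmeticFunction.vonMangoldt m : ℝ) / Real.sqrt m *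
            ∫ t : ℝ, ‖weilMellin g (1 / 2 + t * Complex.I)‖ ^ 2 * Real.cos (t * Real.log m)))
    (a : ℝ) : WeilPositivityOn a ↔ DPos(a, weilPrimeIndex a) := by
  constructor
  · intro h g hg hgs
    rw [← hDF g a hg hgs]
    exact h g hg hgs
  · intro h g hg hgs
    rw [hDF g a hg hgs]
    exact h g hg hgs

/-- `(log n)/2 ≤ (log (n+1))/2` for `n ≥ 1`. [folklore] -/
theorem half_log_le_half_log_succ {n : ℕ} (hn : 1 ≤ n) :
    Real.log (n : ℝ) / 2 ≤ Real.log ((n : ℝ) + 1) / 2 := by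
  have h0 : (0 : ℝ) < n := by exact_mod_cast hn
  have : Real.log (n : ℝ) ≤ Real.log ((n : ℝ) + 1) := Real.log_le_log h0 (by linarith)
  linarith

/-- **Calibration, II: the registered stub `stub_windowGrowth` is the positivity climb**, given the three
analytic statements of the line (density form `hDF`, cutoff invariance `hCI`, high zone `hHZ` — each landed
separately as its own stub; here they are hypotheses). The stub's own hypothesis is `hHZ` verbatim, so it is
discharged; the two density-positivity clauses are `WeilPositivityOn ((log n)/2)` and
`WeilPositivityOn ((log (n+1))/2)` after realigning the cutoff (`densityPos_realign`) and passing through the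
density form (`weilPositivityOn_iff_densityPos`). [folklore] -/
theorem windowGrowth_iff_positivityStep
    (hDF : ∀ (g : ℝ → ℂ) (a : ℝ), IsWeilTest g → tsupport g ⊆ Set.Icc (-a) a →
      (weilQuadratic g).re = weilPoleForm g + 1 / Real.pi *
        ((∫ t : ℝ, ‖weilMellin g (1 / 2 + t * Complex.I)‖ ^ 2 * riemannSiegelThetaDeriv t) -
          ∑ m ∈ weilPrimeIndex a, (ArithmeticFunction.vonMangoldt m : ℝ) / Real.sqrt m *
            ∫ t : ℝ, ‖weilMellin g (1 / 2 + t * Complex.I)‖ ^ 2 * Real.cos (t * Real.log m)))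
    (hCI : ∀ (g : ℝ → ℂ) (a x : ℝ), IsWeilTest g → tsupport g ⊆ Set.Icc (-a) a → 2 * a ≤ |x| →
      ∫ t : ℝ, ‖weilMellin g (1 / 2 + t * Complex.I)‖ ^ 2 * Real.cos (t * x) = 0)
    (hHZ : ∀ (S : Finset ℕ) (t : ℝ),
      2 * Real.pi * Real.exp (2 * (∑ m ∈ S, (ArithmeticFunction.vonMangoldt m : ℝ) / Real.sqrt m) + 2) ≤ |t| →
        ∑ m ∈ S, (ArithmeticFunction.vonMangoldt m : ℝ) / Real.sqrt m * Real.cos (t * Real.log m) <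
          riemannSiegelThetaDeriv t) :
    ((∀ (S : Finset ℕ) (t : ℝ),
      2 * Real.pi * Real.exp (2 * (∑ m ∈ S, (ArithmeticFunction.vonMangoldt m : ℝ) / Real.sqrt m) + 2) ≤ |t| →
        ∑ m ∈ S, (ArithmeticFunction.vonMangoldt m : ℝ) / Real.sqrt m * Real.cos (t * Real.log m) <
          riemannSiegelThetaDeriv t) →
    ∀ n : ℕ, 2 ≤ n →
      DPos(Real.log n / 2, weilPrimeIndex (Real.log ((n : ℝ) + 1) / 2)) →
        DPos(Real.log ((n : ℝ) + 1) / 2, weilPrimeIndex (Real.log ((n : ℝ) + 1) / 2))) ↔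
    ∀ n : ℕ, 2 ≤ n → WeilPositivityOn (Real.log n / 2) →
        WeilPositivityOn (Real.log ((n : ℝ) + 1) / 2) := by
  constructor
  · intro hWG n hn hPos
    have hn1 : 1 ≤ n := le_trans (by norm_num) hn
    have h1 : DPos(Real.log n / 2, weilPrimeIndex (Real.log ((n : ℝ) + 1) / 2)) :=
      (densityPos_realign hCI (half_log_le_half_log_succ hn1)).1
        ((weilPositivityOn_iff_densityPos hDF _).1 hPos)
    exact (weilPositivityOn_iff_densityPos hDF _).2 (hWG hHZ n hn h1)
  · intro hStep _ n hn hDP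
    have hn1 : 1 ≤ n := le_trans (by norm_num) hn
    have hPos : WeilPositivityOn (Real.log n / 2) :=
      (weilPositivityOn_iff_densityPos hDF _).2
        ((densityPos_realign hCI (half_log_le_half_log_succ hn1)).2 hDP)
    exact (weilPositivityOn_iff_densityPos hDF _).1 (hStep n hn hPos)

/-- **Calibration, III: given the three analytic stubs, the held stub `stub_windowGrowth` of line `Sketch`
is exactly the Riemann hypothesis** (RH-implied, hence irrefutable short of `¬RH`; RH-strength, as the
negative lemma `Collapse` demands of every line for this crux). [folklore] -/
theorem windowGrowth_iff_riemannHypothesis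
    (hDF : ∀ (g : ℝ → ℂ) (a : ℝ), IsWeilTest g → tsupport g ⊆ Set.Icc (-a) a →
      (weilQuadratic g).re = weilPoleForm g + 1 / Real.pi *
        ((∫ t : ℝ, ‖weilMellin g (1 / 2 + t * Complex.I)‖ ^ 2 * riemannSiegelThetaDeriv t) -
          ∑ m ∈ weilPrimeIndex a, (ArithmeticFunction.vonMangoldt m : ℝ) / Real.sqrt m *
            ∫ t : ℝ, ‖weilMellin g (1 / 2 + t * Complex.I)‖ ^ 2 * Real.cos (t * Real.log m)))
    (hCI : ∀ (g : ℝ → ℂ) (a x : ℝ), IsWeilTest g → tsupport g ⊆ Set.Icc (-a) a → 2 * a ≤ |x| →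
      ∫ t : ℝ, ‖weilMellin g (1 / 2 + t * Complex.I)‖ ^ 2 * Real.cos (t * x) = 0)
    (hHZ : ∀ (S : Finset ℕ) (t : ℝ),
      2 * Real.pi * Real.exp (2 * (∑ m ∈ S, (ArithmeticFunction.vonMangoldt m : ℝ) / Real.sqrt m) + 2) ≤ |t| →
        ∑ m ∈ S, (ArithmeticFunction.vonMangoldt m : ℝ) / Real.sqrt m * Real.cos (t * Real.log m) <
          riemannSiegelThetaDeriv t) :
    ((∀ (S : Finset ℕ) (t : ℝ),
      2 * Real.pi * Real.exp (2 * (∑ m ∈ S, (ArithmeticFunction.vonMangoldt m : ℝ) / Real.sqrt m) + 2) ≤ |t| →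
        ∑ m ∈ S, (ArithmeticFunction.vonMangoldt m : ℝ) / Real.sqrt m * Real.cos (t * Real.log m) <
          riemannSiegelThetaDeriv t) →
    ∀ n : ℕ, 2 ≤ n →
      DPos(Real.log n / 2, weilPrimeIndex (Real.log ((n : ℝ) + 1) / 2)) →
        DPos(Real.log ((n : ℝ) + 1) / 2, weilPrimeIndex (Real.log ((n : ℝ) + 1) / 2))) ↔
    RiemannHypothesis := by
  rw [windowGrowth_iff_positivityStep hDF hCI hHZ, riemannHypothesis_iff_positivityStep]

end Summit.RiemannHypothesis.RiemannHypothesis.Theorems.SpectralTraceWindowStep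

end
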